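import Summits.BirchSwinnertonDyer.BirchSwinnertonDyer.Theorems.ErratumRoadFiveIMCDivTransferUnrReceptacleOneSidedSigma
import Summits.BirchSwinnertonDyer.BirchSwinnertonDyer.Theorems.ErratumRoadFiveIMCDivOneSidedCongruenceLe
import HarnessLib

/-!
# K2 crux 19270 `IMCDivAtErratumDataAll` (H3♭), ROAD FF in imc-p1's currency — the end form at the
# tree's receptacle with the congruence input F3 = (c) AND the `L`-side `Σ`-identity ONE-SIDED
# (stub S2 `stub_imcDivErratum_splitAtP`: the form whose (c) print delivers at the `p`-new point in
# either reading of [Cas20, Thm. 2.11])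

Cell `bsd-stepL`, PART 1b ACCEL seat `bsd-stepL-imc24b` (prover, row (2), session g3).
`--supports stmt-BirchSwinnertonDyer-19270 --as helper`. HONEST FRAMING: BSD is not proved for any pair
by this file; it closes no item; no definition, no named fact, no `sorry`. It FORKS the last three links
of imc-p1's Road-FF chain (`…TransferDivisibleInvariants` §2–§3 → `…TransferUnrReceptacleOneSidedSigma`)
with ONE change of currency: the congruence of `p`-adic `L`-functions (c) enters as the inclusion
`(L_m) ⊆ (L^Σ_f) + (p)^m` (and the `Σ`-identity as `P_Σ·L_f ∣ L^Σ_f`), the only halves the descent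
reads. Root: this seat's `CongruenceLe.map_fittingIdeal_le_span_of_congruences_le` (p482171). Why this
matters exactly at SPLIT `p` (stub S2 of crux 19270): companion files
`Theorems/ErratumRoadFiveIMCDivPNewSeam.lean` (p482256: the seam `1 − a_p^{-1}σ_𝔭̄` between the `p`-old
display of [Cas20, Thm. 2.11] and the `p`-new frame [Cas18 Thm. 3.1 ∕ Castella JIMJ 17 Thm. 2.10,
β_p = 0] is a unit iff `a_p = −1`) and `…OneSidedCongruenceLe[Defs].lean` (p482171 ∕ p482642: the same
one-sided road in imc24c's `X_ac`-direct currency, packaged, with both registered stub signatures).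

Everything on the Galois ∕ Selmer side (D1, D2, F1, F2, F5, F7-Selmer, torsionness, the receptacle
`ℤ_p⟦T⟧ → R₀⟦T⟧ → 𝓞_{ℂ_p}⟦T⟧`) is imc-p1's, VERBATIM (binders copied from p477148's
`map_charIdeal_le_span_of_roadFF_unr_le`); the proofs are theirs with the root swapped. Credits: imc-p1
(g6–g8), imc24c (𝔪^k-trick), X2 (receptacle algebra).

References: [Castella2018Erratum] Lemma 2.1, Thm. 2.3, proof of Thm. 1.1 (p. 4); [Castella2018] §3,
(3.1), Thm. 3.1, (4.1), p. 11; [Castella2020JIMJ] Def. 2.10, Thm. 2.11; [Castella2018Exceptional] Thm. 2.10;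
[Skinner2016PacificMC] §3.1; [JetchevSkinnerWan2017] §3.3, Prop. 3.3.2, Thm. 6.1.6; [StacksProject] 07ZA.
-/

noncomputable section

open scoped TensorProduct
open Literature.RingTheory.FittingIdeal Literature.NumberTheory.EllipticCurves
  Literature.NumberTheory.EllipticCurves.Module

/-! ### §1 Σ-removal with the `L`-side identity one-sided -/

namespace Summit.BirchSwinnertonDyer.Rank1Residual.X11b.CongruenceLimit

/-- **Σ-removal and receptacle bookkeeping with the `L`-side `Σ`-identity ONE-SIDED**: as imc-p1's
`map_le_span_of_transfer_of_imprimitive_le` (one-sided Selmer input `C^∅·(P_Σ) ⊆ C^Σ`) with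
`hLS : φ(iP_Σ)·L ∣ L^Σ` (the half used) in place of `(L^Σ) = (φ(iP_Σ)·L)`.
[cite: JetchevSkinnerWan2017, §3.3 and Thm. 6.1.6 (proof)] [cite: Castella2018, (3.1)] -/
theorem map_le_span_of_transfer_of_imprimitive_dvd
    {Λ R S T : Type*} [CommRing Λ] [CommRing R] [CommRing S] [IsDomain S] [CommRing T]
    (i : Λ →+* R) (φ : R →+* S) (j : S →+* T)
    {CS C0 : Ideal Λ} {PS : Λ} (hSig : C0 * Ideal.span {PS} ≤ CS) (hP : φ (i PS) ≠ 0)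
    {𝔠 : Ideal R} (hSh : CS.map i ≤ 𝔠)
    {LS L : S} (h𝔠 : 𝔠.map φ ≤ Ideal.span {LS})
    (hLS : φ (i PS) * L ∣ LS)
    {Q : T} (hQ : Ideal.span {j L} = Ideal.span {Q}) :
    C0.map (j.comp (φ.comp i)) ≤ Ideal.span {Q} := by
  -- `C^∅·(P_Σ)·S ⊆ C^Σ·S ⊆ (L^Σ) = (P_Σ · L)`
  have h1 : ((C0 * Ideal.span {PS}).map i).map φ ≤ Ideal.span {φ (i PS) * L} :=
    ((Ideal.map_mono (Ideal.map_mono hSig)).trans ((Ideal.map_mono hSh).trans h𝔠)).trans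
      (Ideal.span_singleton_le_span_singleton.mpr hLS)
  have h2 : ((C0 * Ideal.span {PS}).map i).map φ =
      (C0.map (φ.comp i)) * Ideal.span {φ (i PS)} := by
    rw [Ideal.map_map, Ideal.map_mul, Ideal.map_span, Set.image_singleton, RingHom.comp_apply]
  have h3 : C0.map (φ.comp i) ≤ Ideal.span {L} := by
    rw [h2, mul_comm (φ (i PS)) L, ← Ideal.span_singleton_mul_span_singleton] at h1
    exact (Ideal.span_singleton_mul_left_mono hP).mp h1
  have h4 : (C0.map (φ.comp i)).map j ≤ Ideal.span {j L} := by
    refine (Ideal.map_mono h3).trans (le_of_eq ?_)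
    rw [Ideal.map_span, Set.image_singleton]
  rw [← Ideal.map_map]
  exact h4.trans (le_of_eq hQ)


end Summit.BirchSwinnertonDyer.Rank1Residual.X11b.CongruenceLimit

/-! ### §2 imc-p1's divisible-invariants chain with (c) one-sided -/

namespace Summit.BirchSwinnertonDyer.Rank1Residual.X11b.TorsionControl

open CategoryTheory Literature.NumberTheory.GaloisRepresentations IsLocalRing
open scoped ContRepresentation

universe u v

section General

variable {R : Type u} [CommRing R] [TopologicalSpace R]
variable {Γ : Type u} [Group Γ] [TopologicalSpace Γ] [IsTopologicalGroup Γ]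
variable {ι : Type*} {Γv : ι → Type u} [∀ v, Group (Γv v)] [∀ v, TopologicalSpace (Γv v)]
  [∀ v, IsTopologicalGroup (Γv v)] (φ : ∀ v, Γv v →ₜ* Γ) (L : Set ι)

/-- **`Fitt_R(Sel(M_f)^∨)·S ⊆ (L_f)`, divisible-invariants form, (c) ONE-SIDED** — imc-p1's
`map_fittingIdeal_le_span_of_selmer_congruences_divisible` (p477148's chain, §2) with
`hc m : (L_m) ⊆ (L_f) + (aS)^m` in place of the equality; the root is
`CongruenceLe.map_fittingIdeal_le_span_of_congruences_le` (this seat, p482171), everything else verbatim.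
[cite: Castella2018Erratum, Lemma 2.1 and proof of Thm. 1.1 (p. 4), read one-sidedly]
[cite: Skinner2016PacificMC, §3.1 (p. 192)] [cite: StacksProject, Tag 07ZA] -/
theorem map_fittingIdeal_le_span_of_selmer_congruences_divisible_cLe
    [IsNoetherianRing R] [IsDomain R] [UniqueFactorizationMonoid R] (a : R)
    {Mf : Type u} [AddCommGroup Mf] [Module R Mf] [TopologicalSpace Mf] [DiscreteTopology Mf]
    [ContinuousSMul R Mf] (ρf : ContinuousRep Γ R Mf)
    (hdivf : Function.Surjective fun x : Mf => a • x)
    (hglobf : ∀ m, 1 ≤ m → ∀ w ∈ ρf.toTopRep.ρ.invariants,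
      ∃ w' ∈ ρf.toTopRep.ρ.invariants, a ^ m • w' = w)
    (hlocf : ∀ m, 1 ≤ m → ∀ v ∈ L, ∀ w ∈ ((ρf.restrict (φ v)).toTopRep).ρ.invariants,
      ∃ w' ∈ ((ρf.restrict (φ v)).toTopRep).ρ.invariants, a ^ m • w' = w)
    (Mg : ℕ → Type u) [∀ m, AddCommGroup (Mg m)] [∀ m, Module R (Mg m)]
    [∀ m, TopologicalSpace (Mg m)] [∀ m, DiscreteTopology (Mg m)] [∀ m, ContinuousSMul R (Mg m)]
    (ρg : ∀ m, ContinuousRep Γ R (Mg m))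
    (hdivg : ∀ m, 1 ≤ m → Function.Surjective fun x : Mg m => a • x)
    (hglobg : ∀ m, 1 ≤ m → ∀ w ∈ (ρg m).toTopRep.ρ.invariants,
      ∃ w' ∈ (ρg m).toTopRep.ρ.invariants, a ^ m • w' = w)
    (hlocg : ∀ m, 1 ≤ m → ∀ v ∈ L, ∀ w ∈ (((ρg m).restrict (φ v)).toTopRep).ρ.invariants,
      ∃ w' ∈ (((ρg m).restrict (φ v)).toTopRep).ρ.invariants, a ^ m • w' = w)
    (θ : ∀ m, 1 ≤ m → ((torsionRep (ρg m) (a ^ m)).toTopRep ≅ (torsionRep ρf (a ^ m)).toTopRep))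
    [Module.Finite R (CharacterModule (selmer φ L ρf))]
    [∀ m, Module.Finite R (CharacterModule (selmer φ L (ρg m)))]
    (S : Type v) [CommRing S] [Algebra R S] [IsNoetherianRing S]
    (ha : (Ideal.span {a}).map (algebraMap R S) ≤ (⊥ : Ideal S).jacobson)
    {Lf : S} (Lg : ℕ → S)
    (hCh : ∀ m, 1 ≤ m → Module.IsTorsion R (CharacterModule (selmer φ L (ρg m))) →
      (charIdeal R (CharacterModule (selmer φ L (ρg m)))).map (algebraMap R S) ≤
        Ideal.span {Lg m})
    (hc : ∀ m, 1 ≤ m →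
      Ideal.span {Lg m} ≤ Ideal.span {Lf} ⊔ ((Ideal.span {a}).map (algebraMap R S)) ^ m) :
    (Module.fittingIdeal R (CharacterModule (selmer φ L ρf)) 0).map (algebraMap R S) ≤
      Ideal.span {Lf} :=
  CongruenceLe.map_fittingIdeal_le_span_of_congruences_le S
    (fun m => CharacterModule (selmer φ L (ρg m))) (Ideal.span {a}) ha Lg
    (fun m hm => Classical.choice
      (PontryaginCongruence.nonempty_quotIdealPow_equiv_of_torsionBy_equiv a m
        (Classical.choice (nonempty_torsionBy_selmer_equiv_of_divisible φ L a m ρf (ρg m) hdivf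
          (hglobf m hm) (hlocf m hm) (hdivg m hm) (hglobg m hm) (hlocg m hm) (θ m hm)))))
    (fun m hm => CongruenceLimit.map_fittingIdeal_zero_le_of_map_charIdeal_le S (algebraMap R S)
      (hCh m hm)) hc


end General

section PowerSeries

open PowerSeries

variable {𝒪 : Type} [CommRing 𝒪] [IsDomain 𝒪] [IsDiscreteValuationRing 𝒪]
  [TopologicalSpace (PowerSeries 𝒪)]
  {𝒪' : Type} [CommRing 𝒪'] [IsDomain 𝒪'] [IsPrincipalIdealRing 𝒪'] [Algebra 𝒪 𝒪']
variable {Γ₀ : Type} [Group Γ₀] [TopologicalSpace Γ₀] [IsTopologicalGroup Γ₀]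
variable {ι₀ : Type*} {Γw : ι₀ → Type} [∀ v, Group (Γw v)] [∀ v, TopologicalSpace (Γw v)]
  [∀ v, IsTopologicalGroup (Γw v)] (ψ : ∀ v, Γw v →ₜ* Γ₀) (L₀ : Set ι₀)

/-- **`Ch_{Λ_𝒪}(Sel(M_f)^∨)·𝒪'⟦T⟧ ⊆ (L_f)`, divisible-invariants + torsion-only form, (c)
ONE-SIDED** — imc-p1's `map_charIdeal_le_span_of_selmer_congruences_divisible` with
`hc m : (L_m) ⊆ (L_f) + (a)^m`; the 𝔪^k-trick step (`CongruenceLimit.map_charIdeal_le_span_of_map_fittingIdeal_le`)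
is unchanged. [cite: Castella2018Erratum, Lemma 2.1 and proof of Thm. 1.1 (p. 4), read one-sidedly, Lemma 2.2 bypassed]
[cite: Skinner2016PacificMC, §2.6 (2-6-1) and §3.1 (p. 192)] -/
theorem map_charIdeal_le_span_of_selmer_congruences_divisible_cLe
    (hι : Function.Injective (algebraMap 𝒪 𝒪')) (a : PowerSeries 𝒪)
    {Mf : Type} [AddCommGroup Mf] [Module (PowerSeries 𝒪) Mf] [TopologicalSpace Mf]
    [DiscreteTopology Mf] [ContinuousSMul (PowerSeries 𝒪) Mf] (ρf : ContinuousRep Γ₀ (PowerSeries 𝒪) Mf)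
    (hdivf : Function.Surjective fun x : Mf => a • x)
    (hglobf : ∀ m, 1 ≤ m → ∀ w ∈ ρf.toTopRep.ρ.invariants,
      ∃ w' ∈ ρf.toTopRep.ρ.invariants, a ^ m • w' = w)
    (hlocf : ∀ m, 1 ≤ m → ∀ v ∈ L₀, ∀ w ∈ ((ρf.restrict (ψ v)).toTopRep).ρ.invariants,
      ∃ w' ∈ ((ρf.restrict (ψ v)).toTopRep).ρ.invariants, a ^ m • w' = w)
    (Mg : ℕ → Type) [∀ m, AddCommGroup (Mg m)] [∀ m, Module (PowerSeries 𝒪) (Mg m)]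
    [∀ m, TopologicalSpace (Mg m)] [∀ m, DiscreteTopology (Mg m)]
    [∀ m, ContinuousSMul (PowerSeries 𝒪) (Mg m)] (ρg : ∀ m, ContinuousRep Γ₀ (PowerSeries 𝒪) (Mg m))
    (hdivg : ∀ m, 1 ≤ m → Function.Surjective fun x : Mg m => a • x)
    (hglobg : ∀ m, 1 ≤ m → ∀ w ∈ (ρg m).toTopRep.ρ.invariants,
      ∃ w' ∈ (ρg m).toTopRep.ρ.invariants, a ^ m • w' = w)
    (hlocg : ∀ m, 1 ≤ m → ∀ v ∈ L₀, ∀ w ∈ (((ρg m).restrict (ψ v)).toTopRep).ρ.invariants,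
      ∃ w' ∈ (((ρg m).restrict (ψ v)).toTopRep).ρ.invariants, a ^ m • w' = w)
    (θ : ∀ m, 1 ≤ m → ((torsionRep (ρg m) (a ^ m)).toTopRep ≅ (torsionRep ρf (a ^ m)).toTopRep))
    [Module.Finite (PowerSeries 𝒪) (CharacterModule (selmer ψ L₀ ρf))]
    [∀ m, Module.Finite (PowerSeries 𝒪) (CharacterModule (selmer ψ L₀ (ρg m)))]
    (ha : (Ideal.span {a}).map (algebraMap (PowerSeries 𝒪) (PowerSeries 𝒪')) ≤
      (⊥ : Ideal (PowerSeries 𝒪')).jacobson)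
    {Lf : PowerSeries 𝒪'} (Lg : ℕ → PowerSeries 𝒪')
    (hCh : ∀ m, 1 ≤ m → Module.IsTorsion (PowerSeries 𝒪) (CharacterModule (selmer ψ L₀ (ρg m))) →
      (charIdeal (PowerSeries 𝒪) (CharacterModule (selmer ψ L₀ (ρg m)))).map
        (algebraMap (PowerSeries 𝒪) (PowerSeries 𝒪')) ≤ Ideal.span {Lg m})
    (hc : ∀ m, 1 ≤ m →
      Ideal.span {Lg m} ≤
        Ideal.span {Lf} ⊔ ((Ideal.span {a}).map (algebraMap (PowerSeries 𝒪) (PowerSeries 𝒪'))) ^ m)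
    (hT : Module.IsTorsion (PowerSeries 𝒪) (CharacterModule (selmer ψ L₀ ρf))) :
    (charIdeal (PowerSeries 𝒪) (CharacterModule (selmer ψ L₀ ρf))).map
        (algebraMap (PowerSeries 𝒪) (PowerSeries 𝒪')) ≤ Ideal.span {Lf} :=
  CongruenceLimit.map_charIdeal_le_span_of_map_fittingIdeal_le (algebraMap 𝒪 𝒪') hι hT
    (map_fittingIdeal_le_span_of_selmer_congruences_divisible_cLe ψ L₀ a ρf hdivf hglobf hlocf Mg ρg
      hdivg hglobg hlocg θ (PowerSeries 𝒪') ha Lg hCh hc)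


end PowerSeries

end Summit.BirchSwinnertonDyer.Rank1Residual.X11b.TorsionControl

/-! ### §3 The crux's divisibility conjunct at the tree's receptacle, all `L`-side inputs one-sided -/

namespace Summit.BirchSwinnertonDyer.Rank1Residual.X11b.AcSelmer.XAc

open CategoryTheory Literature.NumberTheory.GaloisRepresentations IsLocalRing NumberField
  IsDedekindDomain Field TorsionControl PowerSeries
  Summit.BirchSwinnertonDyer.Rank1Residual.X11b.Halves
  Summit.BirchSwinnertonDyer.Rank1Residual.X2.HidaLimitAlgebra
open scoped ContRepresentation

/-- **ROAD FF, KERNEL GLUE AT THE TREE's RECEPTACLE — ALL `L`-SIDE INPUTS ONE-SIDED** (twin of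
imc-p1's `map_charIdeal_le_span_of_roadFF_unr_le`, p477148-series, with F3 = (c) as the INCLUSION
`hc m : (L_m) ⊆ (L^Σ_f) + (p)^m` and the `Σ`-identity as the DIVISIBILITY `hLS : P_Σ·L_f ∣ L^Σ_f`;
D1 ∕ D2 ∕ F1 ∕ F2 ∕ F4 ∕ F5 ∕ F7-Selmer-side and the receptacle bookkeeping VERBATIM). Why: at the
`p`-NEW weight-2 point the equality-typed (c) with `L_f` := the Cas18 frame rests on the `p`-new
identification of `ν_f(L_p(𝐟))` ([Cas18, p. 11 L9–11] via the proof of [Cas20, Thm. 2.11], whose printed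
multiplier is the `p`-old one; the seam `1 − a_p^{-1}σ_𝔭̄` is a unit at `a_p = −1`, never at `a_p = +1` —
this seat's `PNewSeam.isUnit_seam_unrSeries_iff`); the inclusion follows in either reading from the family
congruence + `L^Σ_f ∣ ν_f(L^Σ(𝐟))` and is all the descent reads. So with THIS end form the S2 (split)
instance of crux 19270 needs F3 only one-sidedly. CONDITIONAL on its hypotheses only; closes nothing;
BSD proved for no pair. [cite: Castella2018Erratum, Thm. 1.1 ⇐ Thm. 2.3, proof p. 4, read one-sidedly, Lemma 2.2 bypassed]
[cite: Castella2018, §3 (p. 9), (3.1), Thm. 3.1, (4.1), p. 11 L9–11] [cite: Castella2020JIMJ, Thm. 2.11]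
[cite: Skinner2016PacificMC, §3.1 (p. 192)] [cite: JetchevSkinnerWan2017, Prop. 3.3.2 and Thm. 6.1.6 (proof)] -/
theorem map_charIdeal_le_span_of_roadFF_unr_oneSided
    {K : Type} [Field K] [NumberField K] (W : WeierstrassCurve K) (p : ℕ) [Fact p.Prime]
    (κ : ZpExtension K p) (𝔭 : HeightOneSpectrum (𝓞 K)) (Sg : Set (HeightOneSpectrum (𝓞 K)))
    (γ : absoluteGaloisGroup K) [Fact (κ.IsTopGenerator γ)]
    [TopologicalSpace (IwasawaAlgebra p)]
    -- Galois side over `Λ = ℤ_p⟦T⟧`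
    {Γ₀ : Type} [Group Γ₀] [TopologicalSpace Γ₀] [IsTopologicalGroup Γ₀]
    {ι₀ : Type*} {Γw : ι₀ → Type} [∀ v, Group (Γw v)] [∀ v, TopologicalSpace (Γw v)]
    [∀ v, IsTopologicalGroup (Γw v)] (ψ : ∀ v, Γw v →ₜ* Γ₀) (L₀ : Set ι₀)
    {Mf : Type} [AddCommGroup Mf] [Module (IwasawaAlgebra p) Mf] [TopologicalSpace Mf]
    [DiscreteTopology Mf] [ContinuousSMul (IwasawaAlgebra p) Mf]
    (ρf : ContinuousRep Γ₀ (IwasawaAlgebra p) Mf)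
    (hdivf : Function.Surjective fun x : Mf => (C (p : ℤ_[p]) : IwasawaAlgebra p) • x)
    (hglobf : ∀ m, 1 ≤ m → ∀ w ∈ ρf.toTopRep.ρ.invariants,
      ∃ w' ∈ ρf.toTopRep.ρ.invariants, (C (p : ℤ_[p]) : IwasawaAlgebra p) ^ m • w' = w)
    (hlocf : ∀ m, 1 ≤ m → ∀ v ∈ L₀, ∀ w ∈ ((ρf.restrict (ψ v)).toTopRep).ρ.invariants,
      ∃ w' ∈ ((ρf.restrict (ψ v)).toTopRep).ρ.invariants,
        (C (p : ℤ_[p]) : IwasawaAlgebra p) ^ m • w' = w)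
    (Mg : ℕ → Type) [∀ m, AddCommGroup (Mg m)] [∀ m, Module (IwasawaAlgebra p) (Mg m)]
    [∀ m, TopologicalSpace (Mg m)] [∀ m, DiscreteTopology (Mg m)]
    [∀ m, ContinuousSMul (IwasawaAlgebra p) (Mg m)]
    (ρg : ∀ m, ContinuousRep Γ₀ (IwasawaAlgebra p) (Mg m))
    (hdivg : ∀ m, 1 ≤ m → Function.Surjective fun x : Mg m => (C (p : ℤ_[p]) : IwasawaAlgebra p) • x)
    (hglobg : ∀ m, 1 ≤ m → ∀ w ∈ (ρg m).toTopRep.ρ.invariants,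
      ∃ w' ∈ (ρg m).toTopRep.ρ.invariants, (C (p : ℤ_[p]) : IwasawaAlgebra p) ^ m • w' = w)
    (hlocg : ∀ m, 1 ≤ m → ∀ v ∈ L₀, ∀ w ∈ (((ρg m).restrict (ψ v)).toTopRep).ρ.invariants,
      ∃ w' ∈ (((ρg m).restrict (ψ v)).toTopRep).ρ.invariants,
        (C (p : ℤ_[p]) : IwasawaAlgebra p) ^ m • w' = w)
    (θ : ∀ m, 1 ≤ m → ((torsionRep (ρg m) ((C (p : ℤ_[p]) : IwasawaAlgebra p) ^ m)).toTopRep ≅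
      (torsionRep ρf ((C (p : ℤ_[p]) : IwasawaAlgebra p) ^ m)).toTopRep))
    [Module.Finite (IwasawaAlgebra p) (CharacterModule (selmer ψ L₀ ρf))]
    [∀ m, Module.Finite (IwasawaAlgebra p) (CharacterModule (selmer ψ L₀ (ρg m)))]
    -- F1 (Shapiro, inequality direction) and F7 (Σ-removal)
    (hSh : XAc.charIdeal W p κ 𝔭 Sg γ ≤
      Literature.NumberTheory.EllipticCurves.Module.charIdeal (IwasawaAlgebra p)
        (CharacterModule (selmer ψ L₀ ρf)))
    {PS : IwasawaAlgebra p}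
    (hSig : XAc.charIdeal W p κ 𝔭 ∅ γ * Ideal.span {PS} ≤ XAc.charIdeal W p κ 𝔭 Sg γ)
    (hP : PowerSeries.map (toUnr p) PS ≠ 0)
    {LS Lf : UnrSeries p}
    (hLS : PowerSeries.map (toUnr p) PS * Lf ∣ LS)
    -- F4 and F3 in `R₀⟦T⟧`, torsionness of `X_f`
    (Lg : ℕ → UnrSeries p)
    (hCh : ∀ m, 1 ≤ m →
      Module.IsTorsion (IwasawaAlgebra p) (CharacterModule (selmer ψ L₀ (ρg m))) →
      (Literature.NumberTheory.EllipticCurves.Module.charIdeal (IwasawaAlgebra p)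
        (CharacterModule (selmer ψ L₀ (ρg m)))).map (PowerSeries.map (toUnr p)) ≤
          Ideal.span {Lg m})
    (hc : ∀ m, 1 ≤ m →
      Ideal.span {Lg m} ≤ Ideal.span {LS} ⊔ (Ideal.span {(C (p : unrIntegers p) : UnrSeries p)}) ^ m)
    (hT : Module.IsTorsion (IwasawaAlgebra p) (CharacterModule (selmer ψ L₀ ρf)))
    -- the frame in the final receptacle
    {Q : PowerSeries 𝓞_ℂ_[p]}
    (hQ : Ideal.span {PowerSeries.map (R1.unrToCpInt p) Lf} = Ideal.span {Q}) :
    (XAc.charIdeal W p κ 𝔭 ∅ γ).map (PowerSeries.map (R1.toCpInt p)) ≤ Ideal.span {Q} := by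
  letI : Algebra ℤ_[p] (unrIntegers p) := (toUnr p).toAlgebra
  haveI := isDiscreteValuationRing_unrIntegers (p := p)
  have halg : algebraMap (IwasawaAlgebra p) (UnrSeries p) = PowerSeries.map (toUnr p) := rfl
  have hι : Function.Injective (algebraMap ℤ_[p] (unrIntegers p)) := X11b.toUnr_injective
  have hmapC : (Ideal.span {(C (p : ℤ_[p]) : IwasawaAlgebra p)}).map
      (algebraMap (IwasawaAlgebra p) (UnrSeries p)) =
      Ideal.span {(C (p : unrIntegers p) : UnrSeries p)} := by
    rw [halg, Ideal.map_span, Set.image_singleton, map_C, map_natCast]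
  have ha : (Ideal.span {(C (p : ℤ_[p]) : IwasawaAlgebra p)}).map
      (algebraMap (IwasawaAlgebra p) (UnrSeries p)) ≤ (⊥ : Ideal (UnrSeries p)).jacobson := by
    rw [hmapC]
    exact span_C_p_le_jacobson_unrSeries
  have hcomp : (PowerSeries.map (R1.unrToCpInt p)).comp
      ((algebraMap (IwasawaAlgebra p) (UnrSeries p)).comp (RingHom.id (IwasawaAlgebra p))) =
      PowerSeries.map (R1.toCpInt p) := by
    rw [RingHom.comp_id, halg, ← PowerSeries.map_comp, R1.unrToCpInt_comp_toUnr]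
  have hSh' : (XAc.charIdeal W p κ 𝔭 Sg γ).map (RingHom.id (IwasawaAlgebra p)) ≤
      Literature.NumberTheory.EllipticCurves.Module.charIdeal (IwasawaAlgebra p)
        (CharacterModule (selmer ψ L₀ ρf)) := by
    rw [Ideal.map_id]
    exact hSh
  have hP' : algebraMap (IwasawaAlgebra p) (UnrSeries p) (RingHom.id (IwasawaAlgebra p) PS) ≠ 0 := by
    rw [RingHom.id_apply, halg]
    exact hP
  have hLS' : algebraMap (IwasawaAlgebra p) (UnrSeries p) (RingHom.id (IwasawaAlgebra p) PS) *
        Lf ∣ LS := by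
    rw [RingHom.id_apply, halg]
    exact hLS
  have hCh' : ∀ m, 1 ≤ m →
      Module.IsTorsion (IwasawaAlgebra p) (CharacterModule (selmer ψ L₀ (ρg m))) →
      (Literature.NumberTheory.EllipticCurves.Module.charIdeal (IwasawaAlgebra p)
        (CharacterModule (selmer ψ L₀ (ρg m)))).map
          (algebraMap (IwasawaAlgebra p) (UnrSeries p)) ≤ Ideal.span {Lg m} := by
    intro m hm ht
    rw [halg]
    exact hCh m hm ht
  have hc' : ∀ m, 1 ≤ m →
      Ideal.span {Lg m} ≤ Ideal.span {LS} ⊔ ((Ideal.span {(C (p : ℤ_[p]) : IwasawaAlgebra p)}).map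
        (algebraMap (IwasawaAlgebra p) (UnrSeries p))) ^ m := by
    intro m hm
    rw [hmapC]
    exact hc m hm
  have h𝔠 := map_charIdeal_le_span_of_selmer_congruences_divisible_cLe ψ L₀ hι
    (C (p : ℤ_[p]) : IwasawaAlgebra p) ρf hdivf hglobf hlocf Mg ρg hdivg hglobg hlocg θ ha Lg hCh'
    hc' hT
  rw [← hcomp]
  exact CongruenceLimit.map_le_span_of_transfer_of_imprimitive_dvd (RingHom.id (IwasawaAlgebra p))
    (algebraMap (IwasawaAlgebra p) (UnrSeries p)) (PowerSeries.map (R1.unrToCpInt p)) hSig hP' hSh'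
    h𝔠 hLS' hQ


end Summit.BirchSwinnertonDyer.Rank1Residual.X11b.AcSelmer.XAc

end
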